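/-
Copyright: the b2b-balaban T⁴-continuum CRUX team, row NE7b OWNER lineage `t4-ne7b-p1` (gen 118). Project licence.
-/
import Summits.QuantumFields.BalabanUV.T4Continuum.Spine.NE7b.SupTorusEffectiveActionGradient

/-!
# THE BACKGROUND AND THE EFFECTIVE ACTION ARE LIPSCHITZ IN THE POTENTIAL, FIBREWISE, MODULUS `(min(2,a) − λ)⁻¹`: two potentials
# `v₁, v₂` (`v_i′ = u_i`), the first `λ`-semiconvex (`u₁′ ≥ −λ`, `λ < min(2,a)`), two torus fields on the SAME block-average fibre
# solving the respective sitewise equations ⟹ `(min(2,a) − λ)²·Σ_x (φ₁ − φ₂)² ≤ Σ_x (u₂ − u₁)(φ₂ x)²` (the displacement of the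
# background is read off the difference of the forces ALONG ONE background), and the effective actions are sandwiched:
# `Σ_x (v₁ − v₂)(φ₁ x) ≤ W₁(w) − W₂(w) ≤ Σ_x (v₁ − v₂)(φ₂ x)` — no smallness, every block field, every mesh ∕ period ∕ dimension
# (row NE7b, node U5c; (92) + (93) + (96) + TEA + INST BY NAME; [folklore])

Cell `pub-balaban`, sub-cell `t4`, spine estimate NE7b (`T4WeightBudget.RelWeightBound`; the cell's OWN estimate — NOT PRINTED in
[Bałaban 1983–89], NOT PROVED).  Crux-route work under `Spine/NE7b/` by the row OWNER (`t4-ne7b-p1` gen 118) under FREEZE (0)'s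
crux-prover clause — the convex road's twin of the sup road's (81) `…SupBackgroundDataModulus` (there: `ℓ^∞`, two-sided letters,
small ball); NOTHING of Bałaban's is named as a Lean object, valued or asserted; no `T4Continuum/Support` leaf typed; no `def`, no
notation; zero `sorry`.  Imports (BY NAME): the OWNER's (96) `…SupTorusEffectiveActionGradient` (`sq_sum_le_of_strongMonotone`,
`exists_clm_blockLift`; through it (92) `gradient_strongMonotone` ∕ `isMinOn_fibre_of_critical`, (89) `torus_form_coercive`, TEA
`fderiv_action_apply`, INST `fderiv_action_torus_eq_zero`, TDF `torus_operator_form_symm`, (93) `hasDerivAt_phiFour_potential`,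
(86) `hasDerivAt_phiFour`).

WHY (located).  The tower iterates the step with a CHANGING potential (the effective action of one step is the potential term of
the next only approximately; the `φ⁴` couplings flow), so every road needs the modulus of the background and of the effective action
in the potential.  In the convex regime it is two lines: strong monotonicity of `∇S₁` between the two backgrounds, where both field
equations pair to zero against the difference (it lies in `ker Q′t`), leaves only the force difference `(u₂ − u₁)∘φ₂`; and each
background minimises its own action on the common fibre, so testing each action with the other background sandwiches `W₁ − W₂`
between the potential differences read along the two backgrounds.

WHAT IS PROVED ([folklore]):
* §1 (TEA's level: symmetric `At` with a form floor `γ`; ANY `Qt`) **`fibreCritical_sub_pairing_le`** (`(γ − λ)·Σ(φ₁ − φ₂)² ≤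
  Σ (u₂(φ₂ x) − u₁(φ₂ x))·(φ₁ x − φ₂ x)` for `φ₁` fibre-critical for `S₁` (`u₁′ ≥ −λ`), `φ₂` fibre-critical for `S₂`, same fibre),
  **`fibreCritical_sub_sq_le`** (`(γ − λ)²·Σ(φ₁ − φ₂)² ≤ Σ (u₂(φ₂ x) − u₁(φ₂ x))²`), **`fibreMin_sandwich`** (two fibre minimisers on
  a common fibre: `Σ (v₁ − v₂)(φ₁ x) ≤ S₁ φ₁ − S₂ φ₂ ≤ Σ (v₁ − v₂)(φ₂ x)`).
* §2 (the `Beta.Site` carriers, displayed actions) **`torus_background_sub_sq_le`** (two torus fields with the same block means solving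
  the sitewise equations of `u₁` (`u₁′ ≥ −λ`, `λ < min(2,a)`) and of ANY `u₂`: `(min(2,a) − λ)²·Σ_x (φ₁ x − φ₂ x)² ≤
  Σ_x (u₂(φ₂ x) − u₁(φ₂ x))²`), **`torus_effectiveAction_sandwich`** (both `λ`-semiconvex, `λ ≤ min(2,a)`: the sandwich).
* §3 **`phiFour_background_sub_sq_le`** (couplings `(g₁, m₁)`, `(g₂, m₂)`, `0 ≤ g₁`, `−m₁ < min(2,a)`; ANY `g₂, m₂`:
  `(min(2,a) + m₁)²·Σ(φ₁ − φ₂)² ≤ Σ ((g₂ − g₁)(φ₂ x)³ + (m₂ − m₁)(φ₂ x))²`).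
* §4 toy.

HONEST (what this is NOT).  Strong monotonicity + minimality, by name; `ℓ²` on the fine torus (no weights, no locality: a local
change of the potential is NOT shown to move the background only locally — that needs the sup road's two-sided letters or [B4]'s
regional analysis); one-sided curvature; constants OURS; nothing about the measure; cubic periods; scalar skeleton, hard constraint,
not the covariant operators ((A3), NC-NE7b-α UNRULED); nothing of Bałaban's.  BY-NAME EFFECT ON THE WALL: NONE.  NE7b NOT PRINTED ∕
NOT PROVED; spine PROVED 0∕9; rung (B)+1 on a FINITE torus — NOT infinite volume, NOT the mass gap, NOT Clay.  HONEST DEPENDENCY: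
continuum YM on T⁴ ⇐ BetaPertH ∧ nine spine estimates (0∕9 proved); BetaPertH ⇐ (D1) ∧ (D4) ∧ CAP+tail; G-an2-4 gates asym, D1 and
NE2∕3∕4.
-/

set_option autoImplicit false

noncomputable section

namespace Summit.QuantumFields.BalabanUV.T4Continuum.NE7b.SupTorusBackgroundPotentialModulus

open Set Function
open scoped ENNReal
open Literature.MathematicalPhysics.QuantumFieldTheory.Balaban1983to89
open B6QGQLower276 (X blk B side AX)
open B5Hk103ScalarZd (nbhd)
open Beta (Site siteOf windowMap)
open SupTorusDirichletForm (torus_operator_form_symm)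
open SupTorusDirichletFormCoercive (torus_form_coercive)
open SupTorusEffectiveAction (fderiv_action_apply)
open SupTorusEffectiveActionInstance (fderiv_action_torus_eq_zero)
open SupTorusActionConvex (gradient_strongMonotone isMinOn_fibre_of_critical)
open SupTorusActionMinimiser (hasDerivAt_phiFour_potential)
open SupTorusEffectiveActionGradient (sq_sum_le_of_strongMonotone)
open SupPhiFourBackground (hasDerivAt_phiFour)

variable {d : ℕ}

/-! ## §1. TEA's level: two potentials, one fibre -/

section Generic

variable {ι κ : Type*} [Fintype ι]

/-- **THE DISPLACEMENT OF A FIBRE-CRITICAL FIELD UNDER A CHANGE OF POTENTIAL, PAIRING FORM**: symmetric `At` with a form floor `γ`;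
`S_i φ = ½Σ φ·At φ + Σ v_i(φ x)`, `v_i′ = u_i`, `u₁′ ≥ −λ`; `φ₁` fibre-critical for `S₁`, `φ₂` fibre-critical for `S₂`, `Qt φ₁ = Qt φ₂`
⟹ `(γ − λ)·Σ_x (φ₁ x − φ₂ x)² ≤ Σ_x (u₂(φ₂ x) − u₁(φ₂ x))·(φ₁ x − φ₂ x)`. [folklore] -/
theorem fibreCritical_sub_pairing_le (At : (ι → ℝ) →L[ℝ] (ι → ℝ))
    (hAt : ∀ φ ψ : ι → ℝ, ∑ x, ψ x * At φ x = ∑ x, φ x * At ψ x) {γ : ℝ}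
    (hγ : ∀ h : ι → ℝ, γ * ∑ x, h x ^ 2 ≤ ∑ x, h x * At h x) {v₁ u₁ u₁' : ℝ → ℝ} (hv₁ : ∀ t, HasDerivAt v₁ (u₁ t) t)
    (hu₁ : ∀ t, HasDerivAt u₁ (u₁' t) t) {lam : ℝ} (hu₁' : ∀ t, -lam ≤ u₁' t) {v₂ u₂ : ℝ → ℝ}
    (hv₂ : ∀ t, HasDerivAt v₂ (u₂ t) t) (Qt : (ι → ℝ) →L[ℝ] (κ → ℝ)) {φ₁ φ₂ : ι → ℝ} (hQ : Qt φ₁ = Qt φ₂)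
    (hcrit₁ : ∀ h : ι → ℝ, Qt h = 0 →
      fderiv ℝ (fun φ : ι → ℝ => (1 / 2 : ℝ) * ∑ x, φ x * At φ x + ∑ x, v₁ (φ x)) φ₁ h = 0)
    (hcrit₂ : ∀ h : ι → ℝ, Qt h = 0 →
      fderiv ℝ (fun φ : ι → ℝ => (1 / 2 : ℝ) * ∑ x, φ x * At φ x + ∑ x, v₂ (φ x)) φ₂ h = 0) :
    (γ - lam) * ∑ x, (φ₁ x - φ₂ x) ^ 2 ≤ ∑ x, (u₂ (φ₂ x) - u₁ (φ₂ x)) * (φ₁ x - φ₂ x) := by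
  have hker : Qt (φ₁ - φ₂) = 0 := by rw [map_sub, hQ, sub_self]
  have h1 : ∑ x, (At φ₁ x + u₁ (φ₁ x)) * (φ₁ - φ₂) x = 0 := by
    rw [← fderiv_action_apply At hAt hv₁ φ₁ (φ₁ - φ₂)]; exact hcrit₁ _ hker
  have h2 : ∑ x, (At φ₂ x + u₂ (φ₂ x)) * (φ₁ - φ₂) x = 0 := by
    rw [← fderiv_action_apply At hAt hv₂ φ₂ (φ₁ - φ₂)]; exact hcrit₂ _ hker
  have hmono := gradient_strongMonotone At hγ hu₁ hu₁' φ₂ φ₁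
  have hsplit : ∑ x, (At φ₁ x + u₁ (φ₁ x) - (At φ₂ x + u₁ (φ₂ x))) * (φ₁ x - φ₂ x)
      = ∑ x, (At φ₁ x + u₁ (φ₁ x)) * (φ₁ - φ₂) x - ∑ x, (At φ₂ x + u₂ (φ₂ x)) * (φ₁ - φ₂) x
        + ∑ x, (u₂ (φ₂ x) - u₁ (φ₂ x)) * (φ₁ x - φ₂ x) := by
    rw [← Finset.sum_sub_distrib, ← Finset.sum_add_distrib]
    exact Finset.sum_congr rfl fun x _ => by simp only [Pi.sub_apply]; ring
  rw [hsplit, h1, h2, sub_zero, zero_add] at hmono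
  exact hmono

/-- **THE DISPLACEMENT IN `ℓ²`**: under the same letters, `(γ − λ)²·Σ_x (φ₁ x − φ₂ x)² ≤ Σ_x (u₂(φ₂ x) − u₁(φ₂ x))²` (`λ ≤ γ`).
[folklore] -/
theorem fibreCritical_sub_sq_le (At : (ι → ℝ) →L[ℝ] (ι → ℝ))
    (hAt : ∀ φ ψ : ι → ℝ, ∑ x, ψ x * At φ x = ∑ x, φ x * At ψ x) {γ : ℝ}
    (hγ : ∀ h : ι → ℝ, γ * ∑ x, h x ^ 2 ≤ ∑ x, h x * At h x) {v₁ u₁ u₁' : ℝ → ℝ} (hv₁ : ∀ t, HasDerivAt v₁ (u₁ t) t)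
    (hu₁ : ∀ t, HasDerivAt u₁ (u₁' t) t) {lam : ℝ} (hu₁' : ∀ t, -lam ≤ u₁' t) (hγlam : lam ≤ γ) {v₂ u₂ : ℝ → ℝ}
    (hv₂ : ∀ t, HasDerivAt v₂ (u₂ t) t) (Qt : (ι → ℝ) →L[ℝ] (κ → ℝ)) {φ₁ φ₂ : ι → ℝ} (hQ : Qt φ₁ = Qt φ₂)
    (hcrit₁ : ∀ h : ι → ℝ, Qt h = 0 →
      fderiv ℝ (fun φ : ι → ℝ => (1 / 2 : ℝ) * ∑ x, φ x * At φ x + ∑ x, v₁ (φ x)) φ₁ h = 0)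
    (hcrit₂ : ∀ h : ι → ℝ, Qt h = 0 →
      fderiv ℝ (fun φ : ι → ℝ => (1 / 2 : ℝ) * ∑ x, φ x * At φ x + ∑ x, v₂ (φ x)) φ₂ h = 0) :
    (γ - lam) ^ 2 * ∑ x, (φ₁ x - φ₂ x) ^ 2 ≤ ∑ x, (u₂ (φ₂ x) - u₁ (φ₂ x)) ^ 2 :=
  sq_sum_le_of_strongMonotone (sub_nonneg.2 hγlam) (fun x => φ₁ x - φ₂ x) (fun x => u₂ (φ₂ x) - u₁ (φ₂ x))
    (fibreCritical_sub_pairing_le At hAt hγ hv₁ hu₁ hu₁' hv₂ Qt hQ hcrit₁ hcrit₂)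

/-- **THE SANDWICH OF THE FIBRE MINIMA**: if `φ₁` minimises `S₁` and `φ₂` minimises `S₂` on the common fibre `{Qt ψ = Qt φ₁}`
(`Qt φ₂ = Qt φ₁`), then `Σ_x (v₁(φ₁ x) − v₂(φ₁ x)) ≤ S₁ φ₁ − S₂ φ₂ ≤ Σ_x (v₁(φ₂ x) − v₂(φ₂ x))`. [folklore] -/
theorem fibreMin_sandwich (At : (ι → ℝ) →L[ℝ] (ι → ℝ)) {v₁ v₂ : ℝ → ℝ} (Qt : (ι → ℝ) →L[ℝ] (κ → ℝ)) {φ₁ φ₂ : ι → ℝ}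
    (hQ : Qt φ₂ = Qt φ₁)
    (hmin₁ : IsMinOn (fun φ : ι → ℝ => (1 / 2 : ℝ) * ∑ x, φ x * At φ x + ∑ x, v₁ (φ x)) {ψ | Qt ψ = Qt φ₁} φ₁)
    (hmin₂ : IsMinOn (fun φ : ι → ℝ => (1 / 2 : ℝ) * ∑ x, φ x * At φ x + ∑ x, v₂ (φ x)) {ψ | Qt ψ = Qt φ₂} φ₂) :
    ∑ x, (v₁ (φ₁ x) - v₂ (φ₁ x))
        ≤ ((1 / 2 : ℝ) * ∑ x, φ₁ x * At φ₁ x + ∑ x, v₁ (φ₁ x)) - ((1 / 2 : ℝ) * ∑ x, φ₂ x * At φ₂ x + ∑ x, v₂ (φ₂ x)) ∧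
      ((1 / 2 : ℝ) * ∑ x, φ₁ x * At φ₁ x + ∑ x, v₁ (φ₁ x)) - ((1 / 2 : ℝ) * ∑ x, φ₂ x * At φ₂ x + ∑ x, v₂ (φ₂ x))
        ≤ ∑ x, (v₁ (φ₂ x) - v₂ (φ₂ x)) := by
  have h12 : (1 / 2 : ℝ) * ∑ x, φ₁ x * At φ₁ x + ∑ x, v₁ (φ₁ x) ≤ (1 / 2 : ℝ) * ∑ x, φ₂ x * At φ₂ x + ∑ x, v₁ (φ₂ x) :=
    isMinOn_iff.1 hmin₁ φ₂ hQ
  have h21 : (1 / 2 : ℝ) * ∑ x, φ₂ x * At φ₂ x + ∑ x, v₂ (φ₂ x) ≤ (1 / 2 : ℝ) * ∑ x, φ₁ x * At φ₁ x + ∑ x, v₂ (φ₁ x) :=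
    isMinOn_iff.1 hmin₂ φ₁ hQ.symm
  have hd₁ : ∑ x, (v₁ (φ₁ x) - v₂ (φ₁ x)) = ∑ x, v₁ (φ₁ x) - ∑ x, v₂ (φ₁ x) := Finset.sum_sub_distrib _ _
  have hd₂ : ∑ x, (v₁ (φ₂ x) - v₂ (φ₂ x)) = ∑ x, v₁ (φ₂ x) - ∑ x, v₂ (φ₂ x) := Finset.sum_sub_distrib _ _
  constructor <;> linarith

end Generic

/-! ## §2. The torus: two potentials, one block-average fibre -/

section Torus

variable (n : ℕ) (a : ℝ) (s : ℕ) [NeZero s]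
  {Dop Aop : lp (fun _ : X d => ℝ) ∞ →L[ℝ] lp (fun _ : X d => ℝ) ∞}
  (hD : ∀ (f : lp (fun _ : X d => ℝ) ∞) (y : X d), Dop f y = (((n : ℝ) + 1) ^ d)⁻¹ * ∑ p ∈ B n y, f p)
  (hA : ∀ (f : lp (fun _ : X d => ℝ) ∞) (p : X d), Aop f p = ∑ r ∈ nbhd n p, AX n a p r * f r)
  {v₁ u₁ u₁' : ℝ → ℝ} (hv₁ : ∀ t, HasDerivAt v₁ (u₁ t) t) (hu₁ : ∀ t, HasDerivAt u₁ (u₁' t) t)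
  {v₂ u₂ u₂' : ℝ → ℝ} (hv₂ : ∀ t, HasDerivAt v₂ (u₂ t) t) (hu₂ : ∀ t, HasDerivAt u₂ (u₂' t) t)
  {lam : ℝ} (hu₁' : ∀ t, -lam ≤ u₁' t) (hu₂' : ∀ t, -lam ≤ u₂' t)
  {Ef : (Site d ((n + 1) * s) → ℝ) →L[ℝ] lp (fun _ : X d => ℝ) ∞}
  (hEf : ∀ (g : Site d ((n + 1) * s) → ℝ) (q : X d), Ef g q = g (siteOf d ((n + 1) * s) q))
  {Rf : lp (fun _ : X d => ℝ) ∞ →L[ℝ] (Site d ((n + 1) * s) → ℝ)}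
  (hRf : ∀ (h : lp (fun _ : X d => ℝ) ∞) (x : Site d ((n + 1) * s)), Rf h x = h (windowMap d ((n + 1) * s) x))
  {Rc : lp (fun _ : X d => ℝ) ∞ →L[ℝ] (Site d s → ℝ)}
  (hRc : ∀ (h : lp (fun _ : X d => ℝ) ∞) (x : Site d s), Rc h x = h (windowMap d s x))

include hD hA hv₁ hu₁ hu₁' hv₂ hEf hRf hRc in
/-- **THE TORUS BACKGROUND IS LIPSCHITZ IN THE POTENTIAL, FIBREWISE, MODULUS `(min(2,a) − λ)⁻¹`.**  `At = Rf∘Aop∘Ef`,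
`Q′t = Rc∘Dop∘Ef`; `v₁′ = u₁`, `u₁′ ≥ −λ` on `ℝ`, `λ ≤ min(2,a)`; `v₂′ = u₂` ANY differentiable potential.  If `φ₁` solves the
sitewise equation of `u₁`, `φ₂` that of `u₂`, and `Q′t φ₁ = Q′t φ₂`, then
`(min(2,a) − λ)²·Σ_x (φ₁ x − φ₂ x)² ≤ Σ_x (u₂(φ₂ x) − u₁(φ₂ x))²` — every mesh, period, dimension; no smallness. [folklore] -/
theorem torus_background_sub_sq_le (hγ : lam ≤ min 2 a) {φ₁ φ₂ : Site d ((n + 1) * s) → ℝ}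
    (hQ : ((Rc.comp Dop).comp Ef) φ₁ = ((Rc.comp Dop).comp Ef) φ₂)
    (heq₁ : ∀ p : X d, Aop (Ef φ₁) p + u₁ (Ef φ₁ p)
      = (((n : ℝ) + 1) ^ d)⁻¹ * ∑ p' ∈ B n (blk n p), (Aop (Ef φ₁) p' + u₁ (Ef φ₁ p')))
    (heq₂ : ∀ p : X d, Aop (Ef φ₂) p + u₂ (Ef φ₂ p)
      = (((n : ℝ) + 1) ^ d)⁻¹ * ∑ p' ∈ B n (blk n p), (Aop (Ef φ₂) p' + u₂ (Ef φ₂ p'))) :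
    (min 2 a - lam) ^ 2 * ∑ x, (φ₁ x - φ₂ x) ^ 2 ≤ ∑ x, (u₂ (φ₂ x) - u₁ (φ₂ x)) ^ 2 :=
  fibreCritical_sub_sq_le ((Rf.comp Aop).comp Ef) (torus_operator_form_symm n a s hA hEf hRf)
    (torus_form_coercive n a s hA hEf hRf) hv₁ hu₁ hu₁' hγ hv₂ ((Rc.comp Dop).comp Ef) hQ
    (fun h hh => fderiv_action_torus_eq_zero n a s hD hA hEf hRf hRc hv₁ φ₁ heq₁ h hh)
    (fun h hh => fderiv_action_torus_eq_zero n a s hD hA hEf hRf hRc hv₂ φ₂ heq₂ h hh)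

include hD hA hv₁ hu₁ hu₁' hv₂ hu₂ hu₂' hEf hRf hRc in
/-- **THE SANDWICH OF THE TORUS EFFECTIVE ACTIONS**: both potentials `λ`-semiconvex with `λ ≤ min(2,a)`; `φ₁, φ₂` solve the respective
sitewise equations with the same block means ⟹ `Σ_x (v₁(φ₁ x) − v₂(φ₁ x)) ≤ S₁ φ₁ − S₂ φ₂ ≤ Σ_x (v₁(φ₂ x) − v₂(φ₂ x))` — the two
effective actions at the common block field differ by the potential difference read along either background. [folklore] -/
theorem torus_effectiveAction_sandwich (hγ : lam ≤ min 2 a) {φ₁ φ₂ : Site d ((n + 1) * s) → ℝ}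
    (hQ : ((Rc.comp Dop).comp Ef) φ₂ = ((Rc.comp Dop).comp Ef) φ₁)
    (heq₁ : ∀ p : X d, Aop (Ef φ₁) p + u₁ (Ef φ₁ p)
      = (((n : ℝ) + 1) ^ d)⁻¹ * ∑ p' ∈ B n (blk n p), (Aop (Ef φ₁) p' + u₁ (Ef φ₁ p')))
    (heq₂ : ∀ p : X d, Aop (Ef φ₂) p + u₂ (Ef φ₂ p)
      = (((n : ℝ) + 1) ^ d)⁻¹ * ∑ p' ∈ B n (blk n p), (Aop (Ef φ₂) p' + u₂ (Ef φ₂ p'))) :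
    ∑ x, (v₁ (φ₁ x) - v₂ (φ₁ x))
        ≤ ((1 / 2 : ℝ) * ∑ x, φ₁ x * ((Rf.comp Aop).comp Ef) φ₁ x + ∑ x, v₁ (φ₁ x))
          - ((1 / 2 : ℝ) * ∑ x, φ₂ x * ((Rf.comp Aop).comp Ef) φ₂ x + ∑ x, v₂ (φ₂ x)) ∧
      ((1 / 2 : ℝ) * ∑ x, φ₁ x * ((Rf.comp Aop).comp Ef) φ₁ x + ∑ x, v₁ (φ₁ x))
          - ((1 / 2 : ℝ) * ∑ x, φ₂ x * ((Rf.comp Aop).comp Ef) φ₂ x + ∑ x, v₂ (φ₂ x))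
        ≤ ∑ x, (v₁ (φ₂ x) - v₂ (φ₂ x)) :=
  fibreMin_sandwich ((Rf.comp Aop).comp Ef) ((Rc.comp Dop).comp Ef) hQ
    (isMinOn_fibre_of_critical ((Rf.comp Aop).comp Ef) (torus_operator_form_symm n a s hA hEf hRf)
      (torus_form_coercive n a s hA hEf hRf) hv₁ hu₁ hu₁' hγ ((Rc.comp Dop).comp Ef)
      (fun h hh => fderiv_action_torus_eq_zero n a s hD hA hEf hRf hRc hv₁ φ₁ heq₁ h hh))
    (isMinOn_fibre_of_critical ((Rf.comp Aop).comp Ef) (torus_operator_form_symm n a s hA hEf hRf)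
      (torus_form_coercive n a s hA hEf hRf) hv₂ hu₂ hu₂' hγ ((Rc.comp Dop).comp Ef)
      (fun h hh => fderiv_action_torus_eq_zero n a s hD hA hEf hRf hRc hv₂ φ₂ heq₂ h hh))

end Torus

/-! ## §3. Lattice `φ⁴`: the background is Lipschitz in the couplings -/

/-- **THE `φ⁴_d` TORUS BACKGROUND IS LIPSCHITZ IN THE COUPLINGS `(g, m)`, FIBREWISE** (`u_i t = g_i t³ + m_i t`, `0 ≤ g₁`,
`−m₁ < min(2,a)`; `g₂, m₂` ARBITRARY; every side, period, dimension; ANY operators ∕ carrier maps with the displayed actions): two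
fields with the same block means solving the respective `φ⁴` sitewise equations satisfy
`(min(2,a) + m₁)²·Σ_x (φ₁ x − φ₂ x)² ≤ Σ_x ((g₂ − g₁)(φ₂ x)³ + (m₂ − m₁)(φ₂ x))²`. [folklore] -/
theorem phiFour_background_sub_sq_le (n : ℕ) (a : ℝ) (s : ℕ) [NeZero s]
    {Dop Aop : lp (fun _ : X d => ℝ) ∞ →L[ℝ] lp (fun _ : X d => ℝ) ∞}
    (hD : ∀ (f : lp (fun _ : X d => ℝ) ∞) (y : X d), Dop f y = (((n : ℝ) + 1) ^ d)⁻¹ * ∑ p ∈ B n y, f p)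
    (hA : ∀ (f : lp (fun _ : X d => ℝ) ∞) (p : X d), Aop f p = ∑ r ∈ nbhd n p, AX n a p r * f r)
    {Ef : (Site d ((n + 1) * s) → ℝ) →L[ℝ] lp (fun _ : X d => ℝ) ∞}
    (hEf : ∀ (g : Site d ((n + 1) * s) → ℝ) (q : X d), Ef g q = g (siteOf d ((n + 1) * s) q))
    {Rf : lp (fun _ : X d => ℝ) ∞ →L[ℝ] (Site d ((n + 1) * s) → ℝ)}
    (hRf : ∀ (h : lp (fun _ : X d => ℝ) ∞) (x : Site d ((n + 1) * s)), Rf h x = h (windowMap d ((n + 1) * s) x))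
    {Rc : lp (fun _ : X d => ℝ) ∞ →L[ℝ] (Site d s → ℝ)}
    (hRc : ∀ (h : lp (fun _ : X d => ℝ) ∞) (x : Site d s), Rc h x = h (windowMap d s x))
    {g₁ m₁ g₂ m₂ : ℝ} (hg₁ : 0 ≤ g₁) (hm₁ : -m₁ < min 2 a) {φ₁ φ₂ : Site d ((n + 1) * s) → ℝ}
    (hQ : ((Rc.comp Dop).comp Ef) φ₁ = ((Rc.comp Dop).comp Ef) φ₂)
    (heq₁ : ∀ p : X d, Aop (Ef φ₁) p + (g₁ * (Ef φ₁ p) ^ 3 + m₁ * Ef φ₁ p)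
      = (((n : ℝ) + 1) ^ d)⁻¹ * ∑ p' ∈ B n (blk n p), (Aop (Ef φ₁) p' + (g₁ * (Ef φ₁ p') ^ 3 + m₁ * Ef φ₁ p')))
    (heq₂ : ∀ p : X d, Aop (Ef φ₂) p + (g₂ * (Ef φ₂ p) ^ 3 + m₂ * Ef φ₂ p)
      = (((n : ℝ) + 1) ^ d)⁻¹ * ∑ p' ∈ B n (blk n p), (Aop (Ef φ₂) p' + (g₂ * (Ef φ₂ p') ^ 3 + m₂ * Ef φ₂ p'))) :
    (min 2 a + m₁) ^ 2 * ∑ x, (φ₁ x - φ₂ x) ^ 2 ≤ ∑ x, ((g₂ - g₁) * (φ₂ x) ^ 3 + (m₂ - m₁) * φ₂ x) ^ 2 := by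
  have h := torus_background_sub_sq_le n a s hD hA (v₁ := fun t => g₁ / 4 * t ^ 4 + m₁ / 2 * t ^ 2)
    (u₁ := fun t => g₁ * t ^ 3 + m₁ * t) (u₁' := fun t => 3 * g₁ * t ^ 2 + m₁) (hasDerivAt_phiFour_potential g₁ m₁)
    (hasDerivAt_phiFour g₁ m₁) (v₂ := fun t => g₂ / 4 * t ^ 4 + m₂ / 2 * t ^ 2) (u₂ := fun t => g₂ * t ^ 3 + m₂ * t)
    (hasDerivAt_phiFour_potential g₂ m₂) (lam := -m₁) (fun t => by nlinarith [sq_nonneg t]) hEf hRf hRc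
    (by simpa using hm₁.le) hQ heq₁ heq₂
  have hre : ∀ x, g₂ * φ₂ x ^ 3 + m₂ * φ₂ x - (g₁ * φ₂ x ^ 3 + m₁ * φ₂ x)
      = (g₂ - g₁) * φ₂ x ^ 3 + (m₂ - m₁) * φ₂ x := fun x => by ring
  simp only [sub_neg_eq_add, hre] at h
  exact h

/-! ## §4. Toy -/

/-- Toy (§1 `fibreMin_sandwich` on one site, `At = 0`, `Qt = 0`, `v₁ = v₂ = 0`, both minimisers the zero field): `0 ≤ 0 − 0 ≤ 0`. -/
example : ∑ x : Unit, ((fun _ : ℝ => (0 : ℝ)) ((0 : Unit → ℝ) x) - (fun _ : ℝ => (0 : ℝ)) ((0 : Unit → ℝ) x))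
      ≤ ((1 / 2 : ℝ) * ∑ x : Unit, (0 : Unit → ℝ) x * (0 : (Unit → ℝ) →L[ℝ] (Unit → ℝ)) (0 : Unit → ℝ) x
          + ∑ x : Unit, (fun _ : ℝ => (0 : ℝ)) ((0 : Unit → ℝ) x))
        - ((1 / 2 : ℝ) * ∑ x : Unit, (0 : Unit → ℝ) x * (0 : (Unit → ℝ) →L[ℝ] (Unit → ℝ)) (0 : Unit → ℝ) x
          + ∑ x : Unit, (fun _ : ℝ => (0 : ℝ)) ((0 : Unit → ℝ) x)) ∧
    ((1 / 2 : ℝ) * ∑ x : Unit, (0 : Unit → ℝ) x * (0 : (Unit → ℝ) →L[ℝ] (Unit → ℝ)) (0 : Unit → ℝ) x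
          + ∑ x : Unit, (fun _ : ℝ => (0 : ℝ)) ((0 : Unit → ℝ) x))
        - ((1 / 2 : ℝ) * ∑ x : Unit, (0 : Unit → ℝ) x * (0 : (Unit → ℝ) →L[ℝ] (Unit → ℝ)) (0 : Unit → ℝ) x
          + ∑ x : Unit, (fun _ : ℝ => (0 : ℝ)) ((0 : Unit → ℝ) x))
      ≤ ∑ x : Unit, ((fun _ : ℝ => (0 : ℝ)) ((0 : Unit → ℝ) x) - (fun _ : ℝ => (0 : ℝ)) ((0 : Unit → ℝ) x)) :=
  fibreMin_sandwich (ι := Unit) (κ := Unit) 0 (v₁ := fun _ => 0) (v₂ := fun _ => 0) 0 rfl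
    (isMinOn_iff.2 fun ψ _ => by simp) (isMinOn_iff.2 fun ψ _ => by simp)

end Summit.QuantumFields.BalabanUV.T4Continuum.NE7b.SupTorusBackgroundPotentialModulus

end
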